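import Summits.ResolutionOfSingularities.ResolutionOfSingularities.Theorems.WeightedInvariantLocalWeightedDropNCGameRank
import Summits.ResolutionOfSingularities.ResolutionOfSingularities.Theorems.WeightedInvariantLocalWeightedDropSpaceCountGameInvariance

/-!
# The NC count game — TRANSFINITE WINNABILITY `WinsOrd`: the move constructor, coordinate changes, units

Crux item stmt-ResolutionOfSingularities-8899 `WeightedInvariant.LocalWeightedDrop` (route `ResolutionOfSingularities/WeightedInvariant`), ENGINE
skeleton v32, residuals `stub_spaceNCRankDrop` / `stub_wildWideApexFourStartsWon`; strategist line `directrix-cut` (res-L1-w43-strat-1 g7), stub E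
(`stub_endOrdThree`, the ORDINAL endgame one dimension up).  [OURS · L1 W4.3 · seat res-D-pv-006; def-free game bookkeeping over `WinsOrd` /
`gameRank` (res-L1-w43-lead-1, `…NCGameRank`, p525270) and the `WinsIn` invariances of `…SpaceCountGameInvariance` (res-type-056); NOT a statement
of any manuscript; AI-produced, gate-checked, weaker than expert review.]

The three tools the graph lift with ordinal wins (`…NCEndgameOrdLift`) needs and `…NCGameRank` does not state — the `WinsOrd` forms of
`winsIn_move`, `winsIn_germIsNC_of_subst`, `winsIn_germIsNC_unit_mul`:
* `winsOrd_move` — THE MOVE CONSTRUCTOR: a legal move all of whose successors satisfy `∃ γ < α, WinsOrd P γ b'` gives `WinsOrd P α b`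
  (region `{b} ∪ {d | ∃ γ < α, WinsOrd P γ d}`, ranked by `gameRank` off `b` and by `α` at `b`, after disposing of the case that `b` is already
  winnable with value `≤ α`);
* `winsOrd_of_winsOrd_subst`, `winsOrd_subst_of_winsOrd`, `winsOrd_germIsNC_of_subst`, `winsOrd_germIsNC_subst` — LEGAL COORDINATE CHANGES
  (prepend `Ψ` to the first move: `isCountMove_comp`, `moveClause_subst_iff`; the converse by the formal inverse);
* `winsOrd_unit_mul`, `winsOrd_germIsNC_unit_mul` — UNITS (well-founded induction on the value; same move, the `s`-saturations of `b` and `u·b`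
  differ by the unit `u∘Φ(chart)`: `saturation_unit_mul`; slices of units are units).
-/

set_option linter.dupNamespace false -- mandated namespace of this single-conjunct summit

namespace Summit.ResolutionOfSingularities.ResolutionOfSingularities.Theorems

namespace TameFourTupleDrop

open MvPowerSeries Literature.AlgebraicGeometry.Resolution

variable {k : Type} [Field k] {m : ℕ}

/-! ## The move constructor -/

/-- **THE MOVE CONSTRUCTOR FOR `WinsOrd`.**  If some legal move from `b` leads, at every exceptional point, to a live slot whose new position is
transfinitely winnable with value `< α`, then `b` is transfinitely winnable with value `≤ α`. -/
theorem winsOrd_move {P : MvPowerSeries (Fin (m + 1)) k → Prop} {α : Ordinal.{0}} {b : MvPowerSeries (Fin (m + 1)) k}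
    {Φ : Fin (m + 1) → MvPowerSeries (Fin (m + 1)) k} {w : Fin (m + 1) → ℕ} (hmv : IsCountMove Φ w)
    (hcl : MoveClause b Φ w (fun b' => ∃ γ < α, WinsOrd P γ b')) : WinsOrd P α b := by
  classical
  by_cases hb : ∃ γ, γ ≤ α ∧ WinsOrd P γ b
  · obtain ⟨γ, hγ, h⟩ := hb
    exact h.mono hγ
  have hb' : ∀ γ, γ ≤ α → ¬ WinsOrd P γ b := fun γ hγ h => hb ⟨γ, hγ, h⟩
  let T : Set (MvPowerSeries (Fin (m + 1)) k) := {d | d = b ∨ ∃ γ < α, WinsOrd P γ d}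
  let ρ : MvPowerSeries (Fin (m + 1)) k → Ordinal.{0} := fun d => if d = b then α else gameRank P d
  have hρb : ρ b = α := by simp only [ρ, if_pos rfl]
  have hρ : ∀ d, d ≠ b → ρ d = gameRank P d := fun d hd => by simp only [ρ, if_neg hd]
  refine ⟨T, ρ, ?_, Or.inl rfl, hρb.le⟩
  intro d hd hPd
  by_cases hdb : d = b
  · subst hdb
    refine ⟨Φ, w, hmv, hcl.mono fun d' ⟨γ, hγ, hwin⟩ => ?_⟩
    have hd'b : d' ≠ d := fun h => hb' γ hγ.le (h ▸ hwin)
    refine ⟨Or.inr ⟨γ, hγ, hwin⟩, ?_⟩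
    rw [hρ d' hd'b, hρb]
    exact lt_of_le_of_lt (gameRank_le P hwin) hγ
  · rcases hd with hd | ⟨γ, hγ, hwin⟩
    · exact absurd hd hdb
    obtain ⟨Φ', w', hmv', hcl'⟩ := (winsOrd_gameRank P ⟨γ, hwin⟩).exists_move hPd
    refine ⟨Φ', w', hmv', hcl'.mono fun d' ⟨β, hβ, hwin'⟩ => ?_⟩
    have hβα : β < α := lt_of_lt_of_le hβ ((gameRank_le P hwin).trans hγ.le)
    have hd'b : d' ≠ b := fun h => hb' β hβα.le (h ▸ hwin')
    refine ⟨Or.inr ⟨β, hβα, hwin'⟩, ?_⟩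
    rw [hρ d' hd'b, hρ d hdb]
    exact lt_of_le_of_lt (gameRank_le P hwin') hβ

/-- The move constructor with the clause in «same value for all successors» form: successors winnable with value `≤ γ`, `γ < α`. -/
theorem winsOrd_move' {P : MvPowerSeries (Fin (m + 1)) k → Prop} {α γ : Ordinal.{0}} (hγ : γ < α) {b : MvPowerSeries (Fin (m + 1)) k}
    {Φ : Fin (m + 1) → MvPowerSeries (Fin (m + 1)) k} {w : Fin (m + 1) → ℕ} (hmv : IsCountMove Φ w)
    (hcl : MoveClause b Φ w (fun b' => WinsOrd P γ b')) : WinsOrd P α b :=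
  winsOrd_move hmv (hcl.mono fun _ h => ⟨γ, hγ, h⟩)

/-! ## Coordinate changes -/

/-- COORDINATE CHANGES: `WinsOrd P α (Ψ^* b) → WinsOrd P α b` for a legal `Ψ`, provided `P (Ψ^* b) → P b` (prepend `Ψ` to the first move; the
transforms, hence the answers and the new positions, are the same series). -/
theorem winsOrd_of_winsOrd_subst {P : MvPowerSeries (Fin (m + 1)) k → Prop}
    (hP : ∀ (b : MvPowerSeries (Fin (m + 1)) k) (Ψ : Fin (m + 1) → MvPowerSeries (Fin (m + 1)) k),
      (∀ i, constantCoeff (Ψ i) = 0) → IsUnit (Matrix.det (Matrix.of fun i j => coeff (Finsupp.single j 1) (Ψ i))) →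
      P (subst Ψ b) → P b)
    {Ψ : Fin (m + 1) → MvPowerSeries (Fin (m + 1)) k} (hΨ0 : ∀ i, constantCoeff (Ψ i) = 0)
    (hΨdet : IsUnit (Matrix.det (Matrix.of fun i j => coeff (Finsupp.single j 1) (Ψ i))))
    {α : Ordinal.{0}} {b : MvPowerSeries (Fin (m + 1)) k} (h : WinsOrd P α (subst Ψ b)) : WinsOrd P α b := by
  by_cases hPb : P (subst Ψ b)
  · exact winsOrd_of_terminal (hP b Ψ hΨ0 hΨdet hPb) α
  obtain ⟨Φ, w, hmv, hcl⟩ := h.exists_move hPb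
  exact winsOrd_move (isCountMove_comp hΨ0 hΨdet hmv) ((moveClause_subst_iff hΨ0 hmv.1 _).mp hcl)

/-- The converse, via the formal inverse: `WinsOrd P α b → WinsOrd P α (Ψ^* b)`, provided `P` descends along every legal substitution. -/
theorem winsOrd_subst_of_winsOrd {P : MvPowerSeries (Fin (m + 1)) k → Prop}
    (hP : ∀ (b : MvPowerSeries (Fin (m + 1)) k) (Ψ : Fin (m + 1) → MvPowerSeries (Fin (m + 1)) k),
      (∀ i, constantCoeff (Ψ i) = 0) → IsUnit (Matrix.det (Matrix.of fun i j => coeff (Finsupp.single j 1) (Ψ i))) →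
      P (subst Ψ b) → P b)
    {Ψ : Fin (m + 1) → MvPowerSeries (Fin (m + 1)) k} (hΨ0 : ∀ i, constantCoeff (Ψ i) = 0)
    (hΨdet : IsUnit (Matrix.det (Matrix.of fun i j => coeff (Finsupp.single j 1) (Ψ i))))
    {α : Ordinal.{0}} {b : MvPowerSeries (Fin (m + 1)) k} (h : WinsOrd P α b) : WinsOrd P α (subst Ψ b) := by
  obtain ⟨ψ, hψ0, hψΨ, -⟩ := FormalCoordChange.exists_comp_inverse hΨ0 hΨdet
  have hψdet : IsUnit (FormalCoordChange.linMat ψ).det := isUnit_det_linMat_of_comp_eq_X hψ0 hψΨ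
  have hb : subst ψ (subst Ψ b) = b := subst_subst_of_comp_eq_X hΨ0 hψ0 hψΨ b
  refine winsOrd_of_winsOrd_subst hP hψ0 hψdet (b := subst Ψ b) ?_
  rw [hb]
  exact h

/-- `WinsOrd GermIsNC α (Ψ^* b) → WinsOrd GermIsNC α b` for a legal `Ψ`. -/
theorem winsOrd_germIsNC_of_subst {Ψ : Fin (m + 1) → MvPowerSeries (Fin (m + 1)) k} (hΨ0 : ∀ i, constantCoeff (Ψ i) = 0)
    (hΨdet : IsUnit (Matrix.det (Matrix.of fun i j => coeff (Finsupp.single j 1) (Ψ i)))) {α : Ordinal.{0}}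
    {b : MvPowerSeries (Fin (m + 1)) k} (h : WinsOrd GermIsNC α (subst Ψ b)) : WinsOrd GermIsNC α b :=
  winsOrd_of_winsOrd_subst (fun b Ψ hΨ0 hΨdet h => germIsNC_of_germIsNC_subst b Ψ hΨ0 hΨdet h) hΨ0 hΨdet h

/-- `WinsOrd GermIsNC α b → WinsOrd GermIsNC α (Ψ^* b)` for a legal `Ψ`. -/
theorem winsOrd_germIsNC_subst {Ψ : Fin (m + 1) → MvPowerSeries (Fin (m + 1)) k} (hΨ0 : ∀ i, constantCoeff (Ψ i) = 0)
    (hΨdet : IsUnit (Matrix.det (Matrix.of fun i j => coeff (Finsupp.single j 1) (Ψ i)))) {α : Ordinal.{0}}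
    {b : MvPowerSeries (Fin (m + 1)) k} (h : WinsOrd GermIsNC α b) : WinsOrd GermIsNC α (subst Ψ b) :=
  winsOrd_subst_of_winsOrd (fun b Ψ hΨ0 hΨdet h => germIsNC_of_germIsNC_subst b Ψ hΨ0 hΨdet h) hΨ0 hΨdet h

/-! ## Units -/

/-- UNITS: `WinsOrd P α b → WinsOrd P α (u · b)` for `u(0) ≠ 0`, provided `P` is unit-invariant (well-founded induction on `α`; same move — at
an answer the `s`-saturations of the transforms of `b` and `u · b` have the same exponent and differ by the unit `u∘Φ(chart)`, and slices of units
are units). -/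
theorem winsOrd_unit_mul {P : MvPowerSeries (Fin (m + 1)) k → Prop}
    (hP : ∀ b u : MvPowerSeries (Fin (m + 1)) k, constantCoeff u ≠ 0 → P b → P (u * b)) :
    ∀ (α : Ordinal.{0}) (b u : MvPowerSeries (Fin (m + 1)) k), constantCoeff u ≠ 0 → WinsOrd P α b → WinsOrd P α (u * b) := by
  intro α
  induction α using WellFoundedLT.induction with
  | ind α ih =>
    intro b u hu h
    by_cases hPb : P b
    · exact winsOrd_of_terminal (hP b u hu hPb) α
    obtain ⟨Φ, w, hmv, hcl⟩ := h.exists_move hPb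
    refine winsOrd_move hmv ?_
    intro c hc hc0 A' G' hfac' hG'
    obtain ⟨hΦ0, hdet, hw1, -⟩ := hmv
    have hΦs : HasSubst Φ := hasSubst_of_constantCoeff_zero hΦ0
    have hch := CobordantChart.hasSubst_chart w c hc
    have hprime := MvPowerSeries.prime_X' k (0 : Fin (m + 1 + 1))
    -- the transforms of `u` (a unit) and of `b`
    obtain ⟨Uc, hUc⟩ : ∃ Uc, Uc = subst (CobordantChart.chart w c) (subst Φ u) := ⟨_, rfl⟩
    have hUc0 : constantCoeff Uc ≠ 0 := by rw [hUc, constantCoeff_subst_chart_subst hΦ0 hc]; exact hu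
    have hprod : subst (CobordantChart.chart w c) (subst Φ (u * b)) = Uc * subst (CobordantChart.chart w c) (subst Φ b) := by
      rw [hUc, ← coe_substAlgHom hΦs, ← coe_substAlgHom hch, map_mul, map_mul]
    by_cases hb : b = 0
    · exfalso
      apply hG'
      have : X 0 ^ A' * G' = 0 := by
        rw [← hfac', hprod, hb, ← coe_substAlgHom hΦs, map_zero, ← coe_substAlgHom hch, map_zero, mul_zero]
      rcases mul_eq_zero.mp this with h0 | h0
      · exact absurd h0 (pow_ne_zero A' hprime.ne_zero)
      · rw [h0]; exact dvd_zero _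
    have hT : subst (CobordantChart.chart w c) (subst Φ b) ≠ 0 :=
      CobordantChart.subst_chart_ne_zero w c hc (FormalCoordChange.subst_ne_zero_of_isUnit_det hΦ0 hdet hb)
    obtain ⟨A, G, hfac, hG⟩ := CobordantVertexChart.exists_eq_X_pow_mul_not_dvd hT
    have hsat : Uc * (X 0 ^ A * G) = X 0 ^ A' * G' := by rw [← hfac, ← hprod, hfac']
    obtain ⟨-, hG'eq⟩ := saturation_unit_mul hUc0 hG hG' hsat
    obtain ⟨i, hci, γ, hγ, hwin⟩ := hcl c hc hc0 A G hfac hG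
    refine ⟨i, hci, γ, hγ, ?_⟩
    have hpos : X 0 * TupleGame.slice i G' = TupleGame.slice i Uc * (X 0 * TupleGame.slice i G) := by
      rw [hG'eq, slice_mul]; ring
    rw [hpos]
    exact ih γ hγ _ _ (by rw [constantCoeff_slice]; exact hUc0) hwin

/-- `WinsOrd GermIsNC α b → WinsOrd GermIsNC α (u · b)` for `u(0) ≠ 0`. -/
theorem winsOrd_germIsNC_unit_mul {α : Ordinal.{0}} {b : MvPowerSeries (Fin (m + 1)) k} (u : MvPowerSeries (Fin (m + 1)) k)
    (hu : constantCoeff u ≠ 0) (h : WinsOrd GermIsNC α b) : WinsOrd GermIsNC α (u * b) :=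
  winsOrd_unit_mul (fun b u hu h => germIsNC_unit_mul b u hu h) α b u hu h

end TameFourTupleDrop

end Summit.ResolutionOfSingularities.ResolutionOfSingularities.Theorems
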